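import Summits.ValiantsHypothesis.ValiantsHypothesis.Theorems.LacunarySymmetroidMatrixDescartesDoorA26WallBubblingDoublyConfluentFrame
import Summits.ValiantsHypothesis.ValiantsHypothesis.Theorems.LacunarySymmetroidMatrixDescartesDoorA26WallBubblingRelativeDSieve

/-!
# Wall bubbling for `DoorA26` — TWO WEYL PAIRS: NON-DEGENERACY of the Gram-normalised limit BY INERTIA (value-generic stratum)

LINE / STUBS.  Crux `Theses.LacunarySymmetroid.DoorA26` (stmt-ValiantsHypothesis-19979; OPEN, typed, never asserted), line
`Cruxes/DoorA26/Lines/wall_bubbling.lean` (val-idea-15), obligation (W) `Stmt.stub_weylFaces`; statement file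
`Cruxes/DoorA26/Lines/wall_bubbling_ConfluentDoor.lean` rev 4, stratum `Stmt.weylFaces_deepVal` with TWO Weyl pairs and four distinct,
VALUE-GENERIC values (`δ₀ = δ₅ = e₀`, `δ₁ = δ₄ = e₁`, `e₂, e₃`; no relation among the pair sums of `e₀,…,e₃`).  Seat val-sym-door-p2 g13 (W1 #26).

THE POINT.  In the two-dslope frame (W1 #25 `…DoublyConfluentFrame`) the Gram-normalised limit of a cluster is the quadratic form
`Σ_pq c_pq φ_p φ_q` in the slot functions `φ = (e^{e₀t}, e^{e₁t}, e^{e₂t}, e^{e₃t}, t e^{e₁t}, t e^{e₀t})` with a REALISABLE non-zero `c`.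
Unlike the one-pair frame (W2 `…ConfluentNondeg.slot_inj`: the 21 products are distinct functions at a generic face), here the products
`φ₀φ₄ = φ₅φ₁ = t·e^{(e₀+e₁)t}` COINCIDE, so a non-zero `c` COULD give the zero function — exactly when `c` is a multiple of the disjoint pattern
`E₀₄ + E₄₀ − E₁₅ − E₅₁`.  That pattern has inertia `(2,2)` and is NOT realisable (W1 #13 `not_realisable_disjointPattern`): the (D)-sieve of the
line, now acting on FRAME positions.  Hence (def-free):

* `twoPair_classSums_of_det_zero` — MASTER LEMMA for all two-pair strata: if the pair-sum coincidences of the six frame exponents are MODELLED by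
  an integer vector `vv : Fin 6 → ℕ` (`δ0 p + δ0 q = δ0 p₀ + δ0 q₀ ↔ vv p + vv q = vv p₀ + vv q₀`) and the doubly-confluent determinant of `W` vanishes
  identically, then every SLOT-CLASS SUM of the polar Gram of `W` vanishes (slot class = same `vv`-sum, same confluent degree `d = ![0,0,0,0,1,1]`);
  `polar_eq_zero_of_lonely_classSum` — a class consisting of one unordered frame pair forces that Gram entry to vanish;
* `twoPair_lonely`, `twoPair_special_iff`, `fourVG_model` (`decide`) — the value-generic stratum is modelled by `vv = ![0,1,3,7,1,0]` (a Sidon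
  quadruple): every slot class is a single unordered frame pair, except the class `{(0,4),(4,0),(5,1),(1,5)}`;
* **`doublyConfluentDet_ne_zero_of_polar_ne_zero`** — at a value-generic two-Weyl-pair point, a SYMMETRIC frame `W` with ONE non-zero polar Gram
  entry has a doubly-confluent determinant `det(e^{e₀t}(W₀ + tW₅) + e^{e₁t}(W₁ + tW₄) + e^{e₂t}W₂ + e^{e₃t}W₃)` that is NOT identically zero:
  all lonely Gram entries vanish by the Laguerre–Pólya count (`extSum_card_zeros_le`, W4 #1), the special class forces `c₀₄ = −c₁₅ =: x`, so the
  polar Gram IS `x·(E₀₄ + E₄₀ − E₁₅ − E₅₁)`, realisable (`realisable_polarGram`, `realisable_smul`) — contradiction with #13 unless `x = 0`, and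
  then `c = 0`.

USE: W1 #27 `doublyConfluentLimit` (this is its non-degeneracy input, as `confluentDet_ne_zero_of_polar_ne_zero` is W2's) and #28 (door-free
window theorem at two Weyl pairs).  The wall strata (c1)/(c2)/(c3) have two/three/three special classes and the same mechanism (next files).
Nothing in this file bears on (W)/(M)/(R) themselves, on `DoorA26`, on `MatrixDescartes` (stmt-ValiantsHypothesis-18050) or on `VP ≠ VNP`;
registers unchanged.  `--supports stmt-ValiantsHypothesis-19979 --as helper`.

[folklore] linear independence of `t^d e^{wt}` via the Laguerre–Pólya count; [this work] the inertia argument for the coinciding slot.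
-/

-- `Summit.ValiantsHypothesis.ValiantsHypothesis.…` repeats a component by the D-0017 layout
-- (single-conjunct summit), which the `dupNamespace` linter flags; the name is mandated.
set_option linter.dupNamespace false

namespace Summit.ValiantsHypothesis.ValiantsHypothesis.Theorems.LacunarySymmetroidMatrixDescartes.WallBubbling

open Finset Filter Topology Polynomial
open Bubbling (polar polar_comm polar_self det_sum_smul_fin_two extSum_card_zeros_le realisable_polarGram realisable_smul Realisable)
open SecondOrder (not_realisable_disjointPattern)
open scoped BigOperators

/-! ## 1. Class sums of the limit Gram vanish when the doubly-confluent determinant vanishes identically -/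

/-- **CLASS SUMS (master lemma, all two-pair strata).**  Positions: pair A at `0,5` (`δ0 5 = δ0 0`), pair B at `1,4` (`δ0 4 = δ0 1`); `d` is the
confluent degree of a frame position.  If the pair-sum coincidences of the six frame exponents are MODELLED by an integer vector `vv` (`hv`) and
the doubly-confluent determinant of the frame `W` vanishes identically, then for every frame pair `(p₀,q₀)` the sum of the polar Gram entries over
its SLOT CLASS (same `vv`-sum, same degree) vanishes — by the Laguerre–Pólya count (`extSum_card_zeros_le`, W4 #1) against infinitely many zeros.
[this work] -/
theorem twoPair_classSums_of_det_zero (δ0 : Fin 6 → ℝ) (h50 : δ0 5 = δ0 0) (h41 : δ0 4 = δ0 1)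
    (vv : Fin 6 → ℕ) (hv : ∀ p q p₀ q₀ : Fin 6, δ0 p + δ0 q = δ0 p₀ + δ0 q₀ ↔ vv p + vv q = vv p₀ + vv q₀)
    (d : Fin 6 → ℕ) (hd : d = ![0, 0, 0, 0, 1, 1])
    (W : Fin 6 → Matrix (Fin 2) (Fin 2) ℝ)
    (hall : ∀ t : ℝ, ((Real.exp (δ0 0 * t)) • (W 0 + t • W 5) + (Real.exp (δ0 1 * t)) • (W 1 + t • W 4)
        + ∑ k : Fin 2, (Real.exp (δ0 k.succ.succ.castSucc.castSucc * t)) • W k.succ.succ.castSucc.castSucc).det = 0) :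
    ∀ p₀ q₀ : Fin 6, (∑ p : Fin 6, ∑ q : Fin 6,
      if (vv p + vv q = vv p₀ + vv q₀ ∧ d p + d q = d p₀ + d q₀) then polar (W p) (W q) else 0) = 0 := by
  classical
  have hdg5 : d 5 = 1 := by rw [hd]; decide
  have hdg4 : d 4 = 1 := by rw [hd]; decide
  have hdglt : ∀ l : Fin 6, l ≠ 5 → l ≠ 4 → d l = 0 := by rw [hd]; decide
  -- the slot function of a frame position
  have hslot : ∀ (p : Fin 6) (t : ℝ), (if p = 5 then dslope (fun y : ℝ => Real.exp (y * t)) (δ0 0) (δ0 0)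
      else if p = 4 then dslope (fun y : ℝ => Real.exp (y * t)) (δ0 1) (δ0 1) else Real.exp (δ0 p * t))
        = t ^ d p * Real.exp (δ0 p * t) := by
    intro p t
    by_cases hp5 : p = 5
    · subst hp5; rw [if_pos rfl, dslope_exp_same, hdg5, pow_one, h50]
    · by_cases hp4 : p = 4
      · subst hp4
        rw [if_neg hp5, if_pos rfl, dslope_exp_same, hdg4, pow_one, h41]
      · rw [if_neg hp5, if_neg hp4, hdglt p hp5 hp4, pow_zero, one_mul]
  -- pair sums and the slot polynomials
  set F : Finset ℝ := (univ : Finset (Fin 6 × Fin 6)).image (fun pr => δ0 pr.1 + δ0 pr.2) with hF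
  have hmemF : ∀ p q : Fin 6, δ0 p + δ0 q ∈ F := fun p q =>
    Finset.mem_image.mpr ⟨(p, q), Finset.mem_univ _, rfl⟩
  set P : ℝ → ℝ[X] := fun w => ∑ p : Fin 6, ∑ q : Fin 6,
    if δ0 p + δ0 q = w then C (polar (W p) (W q)) * X ^ (d p + d q) else 0 with hP
  -- (a) the extended sum is the doubly-confluent determinant, hence vanishes identically
  have hrep : ∀ t : ℝ, ∑ w ∈ F, (P w).eval t * Real.exp (w * t) = 0 := by
    intro t
    have hlim := hall t
    rw [doublyConfluentDet_eq_quadForm] at hlim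
    rw [← hlim]
    have h1 : ∀ w ∈ F, (P w).eval t * Real.exp (w * t)
        = ∑ p : Fin 6, ∑ q : Fin 6, if δ0 p + δ0 q = w then
            polar (W p) (W q) * t ^ (d p + d q) * Real.exp (w * t) else 0 := by
      intro w _
      rw [hP]
      simp only [eval_finsetSum, Finset.sum_mul]
      refine Finset.sum_congr rfl fun p _ => Finset.sum_congr rfl fun q _ => ?_
      by_cases hval : δ0 p + δ0 q = w
      · rw [if_pos hval, if_pos hval, eval_mul, eval_C, eval_pow, eval_X]
      · rw [if_neg hval, if_neg hval, eval_zero, zero_mul]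
    rw [Finset.sum_congr rfl h1, Finset.sum_comm]
    refine Finset.sum_congr rfl fun p _ => ?_
    rw [Finset.sum_comm]
    refine Finset.sum_congr rfl fun q _ => ?_
    rw [Finset.sum_ite_eq F (δ0 p + δ0 q), if_pos (hmemF p q), hslot p t, hslot q t]
    rw [show (δ0 p + δ0 q) * t = δ0 p * t + δ0 q * t by ring, Real.exp_add, pow_add]
    ring
  -- (b) a crude slot bound: every slot polynomial has degree ≤ 2
  have hdgle : ∀ l : Fin 6, d l ≤ 1 := by rw [hd]; decide
  have hdegP : ∀ w, (P w).natDegree ≤ 2 := by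
    intro w
    rw [hP]
    refine natDegree_sum_le_of_forall_le _ _ fun p _ => natDegree_sum_le_of_forall_le _ _ fun q _ => ?_
    by_cases hval : δ0 p + δ0 q = w
    · rw [if_pos hval]
      refine (natDegree_C_mul_X_pow_le _ _).trans ?_
      have := hdgle p; have := hdgle q; omega
    · rw [if_neg hval, natDegree_zero]; exact Nat.zero_le _
  -- (c) hence EVERY slot polynomial vanishes (Laguerre–Pólya count against infinitely many zeros)
  have hPzero : ∀ w ∈ F, P w = 0 := by
    by_contra hne
    push Not at hne
    have hslots : (∑ w ∈ F, if P w = 0 then 0 else (P w).natDegree + 1) ≤ 3 * F.card + 1 := by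
      have h1 : (∑ w ∈ F, if P w = 0 then 0 else (P w).natDegree + 1) ≤ ∑ w ∈ F, 3 := by
        refine Finset.sum_le_sum fun w _ => ?_
        have := hdegP w
        split_ifs <;> omega
      rw [Finset.sum_const, smul_eq_mul] at h1
      linarith [h1]
    set Z : Finset ℝ := (Finset.range (3 * F.card + 1)).image (fun i : ℕ => (i : ℝ)) with hZ
    have hZcard : Z.card = 3 * F.card + 1 := by
      rw [hZ, Finset.card_image_of_injective _ Nat.cast_injective, Finset.card_range]
    have hle := extSum_card_zeros_le (3 * F.card) F P hne hslots Z (fun z _ => hrep z)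
    omega
  -- (d) class sums
  intro p₀ q₀
  have hcoeff : (P (δ0 p₀ + δ0 q₀)).coeff (d p₀ + d q₀)
      = ∑ p : Fin 6, ∑ q : Fin 6, if (δ0 p + δ0 q = δ0 p₀ + δ0 q₀ ∧ d p + d q = d p₀ + d q₀)
          then polar (W p) (W q) else 0 := by
    rw [hP]
    simp only [finsetSum_coeff]
    refine Finset.sum_congr rfl fun p _ => Finset.sum_congr rfl fun q _ => ?_
    by_cases hval : δ0 p + δ0 q = δ0 p₀ + δ0 q₀
    · rw [if_pos hval, coeff_C_mul_X_pow]
      by_cases hdeq : d p₀ + d q₀ = d p + d q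
      · rw [if_pos hdeq, if_pos ⟨hval, hdeq.symm⟩]
      · rw [if_neg hdeq, if_neg (fun h => hdeq h.2.symm)]
    · rw [if_neg hval, coeff_zero, if_neg (fun h => hval h.1)]
  have h0 : (P (δ0 p₀ + δ0 q₀)).coeff (d p₀ + d q₀) = 0 := by rw [hPzero _ (hmemF p₀ q₀), coeff_zero]
  rw [hcoeff] at h0
  refine Eq.trans ?_ h0
  refine Finset.sum_congr rfl fun p _ => Finset.sum_congr rfl fun q _ => ?_
  exact if_congr (by rw [hv]) rfl rfl

/-- **Lonely classes give zero entries.**  If the slot class of `(p₀,q₀)` is the single unordered pair `{p₀,q₀}` and its class sum vanishes, then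
`polar(W p₀, W q₀) = 0`. [folklore] -/
theorem polar_eq_zero_of_lonely_classSum (W : Fin 6 → Matrix (Fin 2) (Fin 2) ℝ) (p₀ q₀ : Fin 6)
    (K : Fin 6 → Fin 6 → Prop) [∀ p q, Decidable (K p q)]
    (hK : ∀ p q, K p q ↔ (p = p₀ ∧ q = q₀) ∨ (p = q₀ ∧ q = p₀))
    (hsum : (∑ p : Fin 6, ∑ q : Fin 6, if K p q then polar (W p) (W q) else 0) = 0) :
    polar (W p₀) (W q₀) = 0 := by
  classical
  have h : (∑ p : Fin 6, ∑ q : Fin 6, if (p = p₀ ∧ q = q₀) ∨ (p = q₀ ∧ q = p₀) then polar (W p) (W q) else 0) = 0 := by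
    refine Eq.trans ?_ hsum
    refine Finset.sum_congr rfl fun p _ => Finset.sum_congr rfl fun q _ => ?_
    exact if_congr (hK p q).symm rfl rfl
  by_cases hpq : p₀ = q₀
  · subst hpq
    have : ∀ p q : Fin 6, ((p = p₀ ∧ q = p₀) ∨ (p = p₀ ∧ q = p₀)) ↔ (p = p₀ ∧ q = p₀) := fun p q => or_self_iff
    simp only [this] at h
    rw [Finset.sum_eq_single p₀ (fun p _ hp => by simp [hp]) (fun h' => absurd (Finset.mem_univ _) h')] at h
    rw [Finset.sum_eq_single p₀ (fun q _ hq => by simp [hq]) (fun h' => absurd (Finset.mem_univ _) h')] at h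
    simpa using h
  · have hsplit : ∀ p q : Fin 6, (if (p = p₀ ∧ q = q₀) ∨ (p = q₀ ∧ q = p₀) then polar (W p) (W q) else 0)
        = (if (p = p₀ ∧ q = q₀) then polar (W p) (W q) else 0) + (if (p = q₀ ∧ q = p₀) then polar (W p) (W q) else 0) := by
      intro p q
      by_cases h1 : p = p₀ ∧ q = q₀
      · have h2 : ¬ (p = q₀ ∧ q = p₀) := fun h2 => hpq (h1.1.symm.trans h2.1)
        rw [if_pos (Or.inl h1), if_pos h1, if_neg h2, add_zero]
      · by_cases h2 : p = q₀ ∧ q = p₀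
        · rw [if_pos (Or.inr h2), if_neg h1, if_pos h2, zero_add]
        · rw [if_neg (not_or.mpr ⟨h1, h2⟩), if_neg h1, if_neg h2, add_zero]
    simp only [hsplit, Finset.sum_add_distrib] at h
    have hA : ∑ p : Fin 6, ∑ q : Fin 6, (if (p = p₀ ∧ q = q₀) then polar (W p) (W q) else 0) = polar (W p₀) (W q₀) := by
      rw [Finset.sum_eq_single p₀ (fun p _ hp => by simp [hp]) (fun h' => absurd (Finset.mem_univ _) h')]
      rw [Finset.sum_eq_single q₀ (fun q _ hq => by simp [hq]) (fun h' => absurd (Finset.mem_univ _) h')]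
      simp
    have hB : ∑ p : Fin 6, ∑ q : Fin 6, (if (p = q₀ ∧ q = p₀) then polar (W p) (W q) else 0) = polar (W p₀) (W q₀) := by
      rw [Finset.sum_eq_single q₀ (fun p _ hp => by simp [hp]) (fun h' => absurd (Finset.mem_univ _) h')]
      rw [Finset.sum_eq_single p₀ (fun q _ hq => by simp [hq]) (fun h' => absurd (Finset.mem_univ _) h')]
      simp [polar_comm]
    rw [hA, hB] at h
    linarith

/-! ## 2. Slot bookkeeping at a VALUE-GENERIC two-Weyl-pair point (integer model, decidable keys) -/

/-- **Integer model of the value-generic stratum** (`decide`): for the Sidon quadruple `v = ![0,1,3,7]`, `v a + v b = v c + v e` iff the pairs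
agree. [folklore] -/
theorem fourVG_model (v : Fin 4 → ℕ) (hvd : v = ![0, 1, 3, 7]) :
    ∀ a b c e : Fin 4, v a + v b = v c + v e ↔ ((a = c ∧ b = e) ∨ (a = e ∧ b = c)) := by
  subst hvd
  decide

/-- **Lonely classes** (`decide`).  With the integer model `vv = ![0,1,3,7,1,0]` of the frame exponents at a value-generic two-pair point and the
confluent degree `d = ![0,0,0,0,1,1]`: outside the special class `{(0,4),(4,0),(5,1),(1,5)}`, two ordered frame pairs with the same model sum and
the same degree are equal up to order. [this work] -/
theorem twoPair_lonely (vv : Fin 6 → ℕ) (hvv : vv = ![0, 1, 3, 7, 1, 0]) (d : Fin 6 → ℕ) (hd : d = ![0, 0, 0, 0, 1, 1]) :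
    ∀ p q p₀ q₀ : Fin 6, (vv p + vv q = vv p₀ + vv q₀ ∧ d p + d q = d p₀ + d q₀) →
      ¬ ((p₀ = 0 ∧ q₀ = 4) ∨ (p₀ = 4 ∧ q₀ = 0) ∨ (p₀ = 1 ∧ q₀ = 5) ∨ (p₀ = 5 ∧ q₀ = 1)) →
      (p = p₀ ∧ q = q₀) ∨ (p = q₀ ∧ q = p₀) := by
  subst hvv hd
  intro p q p₀ q₀
  revert p q
  fin_cases p₀ <;> fin_cases q₀ <;> decide

/-- **The special class** (`decide`): the model class of `(0,4)` is `{(0,4),(4,0),(5,1),(1,5)}`. [this work] -/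
theorem twoPair_special_iff (vv : Fin 6 → ℕ) (hvv : vv = ![0, 1, 3, 7, 1, 0]) (d : Fin 6 → ℕ) (hd : d = ![0, 0, 0, 0, 1, 1]) :
    ∀ p q : Fin 6, ((vv p + vv q = vv 0 + vv 4 ∧ d p + d q = d 0 + d 4) ↔
        ((p = 0 ∧ q = 4) ∨ (p = 4 ∧ q = 0) ∨ (p = 1 ∧ q = 5) ∨ (p = 5 ∧ q = 1))) := by
  subst hvv hd
  decide

/-! ## 3. Non-degeneracy at a value-generic two-Weyl-pair point -/

/-- **NON-DEGENERACY OF THE DOUBLY-CONFLUENT LIMIT (value-generic two-Weyl-pair point).**  Positions: pair A at `0,5` (`δ0 5 = δ0 0`), pair B at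
`1,4` (`δ0 4 = δ0 1`), ordinary letters at `2, 3`; the four values `δ0 0, δ0 1, δ0 2, δ0 3` are VALUE-GENERIC (`hvg`: a coincidence of their pair sums
is a coincidence of the pairs — in particular they are distinct and carry no mixed or disjoint relation).  If the letters `W` are symmetric and some
polar Gram entry is non-zero, the doubly-confluent determinant is not identically zero. [this work] -/
theorem doublyConfluentDet_ne_zero_of_polar_ne_zero (δ0 : Fin 6 → ℝ) (h50 : δ0 5 = δ0 0) (h41 : δ0 4 = δ0 1)
    (hvg : ∀ a b c d : Fin 4, δ0 a.castSucc.castSucc + δ0 b.castSucc.castSucc = δ0 c.castSucc.castSucc + δ0 d.castSucc.castSucc →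
      (a = c ∧ b = d) ∨ (a = d ∧ b = c))
    (W : Fin 6 → Matrix (Fin 2) (Fin 2) ℝ) (hWs : ∀ l, (W l).IsSymm) (hW : ∃ p q, polar (W p) (W q) ≠ 0) :
    ∃ t, ((Real.exp (δ0 0 * t)) • (W 0 + t • W 5) + (Real.exp (δ0 1 * t)) • (W 1 + t • W 4)
        + ∑ k : Fin 2, (Real.exp (δ0 k.succ.succ.castSucc.castSucc * t)) • W k.succ.succ.castSucc.castSucc).det ≠ 0 := by
  classical
  by_contra hall
  push Not at hall
  -- the four values, the reduction of frame positions, the integer model, the confluent degree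
  set E : Fin 4 → ℝ := fun a => δ0 a.castSucc.castSucc with hE
  set ρ : Fin 6 → Fin 4 := ![0, 1, 2, 3, 1, 0] with hρdef
  set v : Fin 4 → ℕ := ![0, 1, 3, 7] with hvd
  set vv : Fin 6 → ℕ := ![0, 1, 3, 7, 1, 0] with hvvd
  set dg : Fin 6 → ℕ := ![0, 0, 0, 0, 1, 1] with hdgdef
  have hρ : ∀ l : Fin 6, δ0 l = E (ρ l) := by
    intro l
    fin_cases l
    · rfl
    · rfl
    · rfl
    · rfl
    · exact h41
    · exact h50
  have hvvρ : ∀ l : Fin 6, vv l = v (ρ l) := by intro l; fin_cases l <;> rfl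
  have hmodel := fourVG_model v hvd
  -- the model describes the coincidences of the frame exponents exactly
  have hv : ∀ p q p₀ q₀ : Fin 6, δ0 p + δ0 q = δ0 p₀ + δ0 q₀ ↔ vv p + vv q = vv p₀ + vv q₀ := by
    intro p q p₀ q₀
    rw [hρ p, hρ q, hρ p₀, hρ q₀, hvvρ p, hvvρ q, hvvρ p₀, hvvρ q₀, hmodel]
    constructor
    · exact hvg _ _ _ _
    · rintro (⟨h1, h2⟩ | ⟨h1, h2⟩)
      · rw [h1, h2]
      · rw [h1, h2, add_comm]
  have hσ := twoPair_classSums_of_det_zero δ0 h50 h41 vv hv dg hdgdef W hall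
  -- (e) lonely entries vanish
  have hzero : ∀ p₀ q₀ : Fin 6, ¬ ((p₀ = 0 ∧ q₀ = 4) ∨ (p₀ = 4 ∧ q₀ = 0) ∨ (p₀ = 1 ∧ q₀ = 5) ∨ (p₀ = 5 ∧ q₀ = 1)) →
      polar (W p₀) (W q₀) = 0 := by
    intro p₀ q₀ hsp
    refine polar_eq_zero_of_lonely_classSum W p₀ q₀
      (fun p q => (vv p + vv q = vv p₀ + vv q₀ ∧ dg p + dg q = dg p₀ + dg q₀)) ?_ (hσ p₀ q₀)
    intro p q
    constructor
    · exact fun hk => twoPair_lonely vv hvvd dg hdgdef p q p₀ q₀ hk hsp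
    · rintro (⟨rfl, rfl⟩ | ⟨rfl, rfl⟩)
      · exact ⟨rfl, rfl⟩
      · exact ⟨add_comm _ _, add_comm _ _⟩
  -- (f) the special class: `c₀₄ + c₁₅ = 0`
  set x : ℝ := polar (W 0) (W 4) with hx
  have hrel : polar (W 1) (W 5) = -x := by
    have h := hσ 0 4
    simp only [twoPair_special_iff vv hvvd dg hdgdef] at h
    simp [Fin.sum_univ_six] at h
    linarith [h, polar_comm (W 4) (W 0), polar_comm (W 5) (W 1)]
  -- (g) hence the polar Gram is `x` times the disjoint pattern on `(0,4 | 1,5)`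
  have hentry : ∀ a b : Fin 6, polar (W a) (W b)
      = x * ((if a = 0 ∧ b = 4 then (1 : ℝ) else 0) + (if a = 4 ∧ b = 0 then 1 else 0)
          - (if a = 1 ∧ b = 5 then 1 else 0) - (if a = 5 ∧ b = 1 then 1 else 0)) := by
    intro a b
    by_cases hs : (a = 0 ∧ b = 4) ∨ (a = 4 ∧ b = 0) ∨ (a = 1 ∧ b = 5) ∨ (a = 5 ∧ b = 1)
    · rcases hs with ⟨rfl, rfl⟩ | ⟨rfl, rfl⟩ | ⟨rfl, rfl⟩ | ⟨rfl, rfl⟩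
      · simpa using hx.symm
      · rw [polar_comm]; simpa using hx.symm
      · simp [hrel]
      · rw [polar_comm]; simp [hrel]
    · rw [hzero a b hs]
      have h1 : ¬ (a = 0 ∧ b = 4) := fun h => hs (Or.inl h)
      have h2 : ¬ (a = 4 ∧ b = 0) := fun h => hs (Or.inr (Or.inl h))
      have h3 : ¬ (a = 1 ∧ b = 5) := fun h => hs (Or.inr (Or.inr (Or.inl h)))
      have h4 : ¬ (a = 5 ∧ b = 1) := fun h => hs (Or.inr (Or.inr (Or.inr h)))
      rw [if_neg h1, if_neg h2, if_neg h3, if_neg h4]; ring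
  -- (h) `x ≠ 0` (else every entry vanishes) — and then the disjoint pattern would be realisable
  have hx0 : x ≠ 0 := by
    intro hx0
    obtain ⟨p, q, hpq⟩ := hW
    exact hpq (by rw [hentry p q, hx0, zero_mul])
  have hreal : Realisable (Matrix.of fun a b : Fin 6 =>
      (if a = 0 ∧ b = 4 then (1 : ℝ) else 0) + (if a = 4 ∧ b = 0 then 1 else 0)
        - (if a = 1 ∧ b = 5 then 1 else 0) - (if a = 5 ∧ b = 1 then 1 else 0)) := by
    have hG := realisable_smul x⁻¹ (realisable_polarGram W hWs)
    convert hG using 1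
    ext a b
    rw [Matrix.smul_apply, Matrix.of_apply, Matrix.of_apply, hentry a b, smul_eq_mul, ← mul_assoc, inv_mul_cancel₀ hx0, one_mul]
  exact not_realisable_disjointPattern 0 4 1 5 (by decide) (by decide) (by decide) (by decide) (by decide) (by decide) hreal

end Summit.ValiantsHypothesis.ValiantsHypothesis.Theorems.LacunarySymmetroidMatrixDescartes.WallBubbling
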